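import Summits.CriticalPhenomena.PercolationContinuityZ3.Theorems.PercNearOneGluingNoHeavyLowerTailSunflowerMultiPetalUpperOnePetal
import Summits.CriticalPhenomena.PercolationContinuityZ3.Theorems.PercNearOneGluingNoHeavyLowerTailSunflowerMultiPetalRestriction
import HarnessLib
import HarnessLib.Audit

/-!
# `NoHeavyLowerTail` (crux stmt-CriticalPhenomena-4575), abstract sunflower cubic, `k` petals: (MZₖ) at every coordinate whose SINGLETON is not a
# bottom set, and ★ₖ for every monotone map into `M_k` all of whose singletons are petal or kernel sets

Support file (seat `prim-l12-p2` gen 27; `--supports stmt-CriticalPhenomena-4575`; companion of `…SunflowerMultiPetal` (p338110),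
`…SunflowerMultiPetalRestriction` (p340634: `MSunflower.ZKW`, `RestrictionMonotonicityK`), `…SunflowerMultiPetalUpperOnePetal` (p341252:
`MSunflower.nested_le_nested_insert_of_upper_le_one_petal`) and, for `k = 3`, of this seat's gen-7 file `…SunflowerRestrictionSingleton`
(`Sunflower.ZH_nonneg_of_forall_lab_singleton_ne_zero`)).  No `sorry`; nothing is asserted about the crux.
Memo: run/shared/lean/prim/prim-l12/prim-l12-p2/FINDING-g27-EXHAUSTIVE-N6-AND-FORMS.md §3.

OBSERVATION (this work).  If the singleton `{e}` is not a bottom set (`lab {e} ≠ 0`), then by monotonicity every upper label `lab (insert e X)` is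
`lab {e}` itself or the top: the UPPER section along `e` uses at most one petal colour.  Hence the upper-one-petal certificate of p341252 applies at `e`
for EVERY number `k` of petals (for `k = 3` the gen-7 file proved this case by a different, symmetrised certificate):

* `MSunflower.lab_insert_of_lab_singleton_ne_zero` — `lab (insert e X) ∈ {0, lab {e}, ⊤}` (in fact `∈ {lab {e}, ⊤}`).
* `MSunflower.ZKW_le_ZKW_insert_of_lab_singleton_ne_zero` — **(MZₖ) at `e` whenever `lab {e} ≠ 0`**: `ZKW W ≤ ZKW (insert e W)` for `e ∉ W`.
* `MSunflower.ZKW_nonneg_of_forall_lab_singleton_ne_zero` — ★ₖ on every sub-cube `2^W` all of whose singletons are petal or kernel sets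
  (induction on `W` from `ZKW ∅ = 0`), and the whole-type form `MSunflower.ZK_nonneg_of_forall_lab_singleton_ne_zero`:
  **`0 ≤ ZK` for every `MSunflower k α` with `lab {e} ≠ 0` for all `e`** — in the `(A up-set, B down-set, components)` language of the gen-26 memo:
  the component-finest partition lemma holds whenever the bottom family is `{∅}` (`ZK_nonneg_of_forall_singleton_mem`).
Consequently a minimal counterexample to `PartitionLemmaK` (if any) has a coordinate whose singleton is a bottom set; with the gen-27 exhaustive
census (memo §1) it has at least 7 points.
-/

namespace Summit.CriticalPhenomena.PercolationContinuityZ3.Theorems.SunflowerPartition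

open Finset

variable {α : Type*} [DecidableEq α]

namespace MSunflower

variable {k : ℕ} (F : MSunflower k α)

/-- If the singleton `{e}` is not a bottom set then every upper label `lab (insert e X)` is bottom (never, in fact), `lab {e}` or top.
[this work] -/
theorem lab_insert_of_lab_singleton_ne_zero (e : α) (X : Finset α) (h : F.lab {e} ≠ 0) :
    F.lab (insert e X) = 0 ∨ F.lab (insert e X) = F.lab {e} ∨ F.lab (insert e X) = Fin.last (k + 1) := by
  have hsub : ({e} : Finset α) ⊆ insert e X := by
    intro x hx
    rw [mem_singleton] at hx
    rw [hx]
    exact mem_insert_self e X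
  rcases F.lab_mono hsub with h1 | h1 | h1
  · exact Or.inr (Or.inl h1.symm)
  · exact absurd h1 h
  · exact Or.inr (Or.inr h1)

/-- **(MZₖ) at a coordinate whose singleton is not a bottom set** (this work): for `e ∉ W` with `lab {e} ≠ 0`,
`ZKW W ≤ ZKW (insert e W)` — every number `k` of petals. [this work] -/
theorem ZKW_le_ZKW_insert_of_lab_singleton_ne_zero (W : Finset α) (e : α) (he : e ∉ W) (h : F.lab {e} ≠ 0) :
    F.ZKW W ≤ F.ZKW (insert e W) := by
  unfold ZKW
  exact F.nested_le_nested_insert_of_upper_le_one_petal W e he (F.lab {e})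
    (fun X _ => F.lab_insert_of_lab_singleton_ne_zero e X h)

/-- **★ₖ on a sub-cube all of whose singletons are petal or kernel sets** (this work): `0 ≤ ZKW W` whenever `lab {e} ≠ 0` for every `e ∈ W`
(induction on `W` from `ZKW ∅ = 0`). [this work] -/
theorem ZKW_nonneg_of_forall_lab_singleton_ne_zero (W : Finset α) (hW : ∀ e ∈ W, F.lab {e} ≠ 0) : 0 ≤ F.ZKW W := by
  induction W using Finset.induction_on with
  | empty => rw [F.ZKW_empty]
  | insert e W' he ih =>
    have h1 : 0 ≤ F.ZKW W' := ih fun x hx => hW x (mem_insert_of_mem hx)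
    exact le_trans h1 (F.ZKW_le_ZKW_insert_of_lab_singleton_ne_zero W' e he (hW e (mem_insert_self e W')))

/-- **★ₖ when every singleton is a petal or kernel set** (this work; whole-type form): `0 ≤ ZK`. [this work] -/
theorem ZK_nonneg_of_forall_lab_singleton_ne_zero [Fintype α] (h : ∀ e : α, F.lab {e} ≠ 0) : 0 ≤ F.ZK := by
  rw [← F.ZKW_univ]
  exact F.ZKW_nonneg_of_forall_lab_singleton_ne_zero univ fun e _ => h e

/-- The same in the `(A, V)` language: ★ₖ holds as soon as every singleton lies in the kernel or in some petal up-set `V i`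
(equivalently: the bottom family is `{∅}`). [this work] -/
theorem ZK_nonneg_of_forall_singleton_mem [Fintype α] (h : ∀ e : α, {e} ∈ F.A ∨ ∃ i, {e} ∈ F.V i) : 0 ≤ F.ZK := by
  refine F.ZK_nonneg_of_forall_lab_singleton_ne_zero fun e he => ?_
  rw [F.lab_eq_zero_iff] at he
  rcases h e with hA | ⟨i, hi⟩
  · exact he.1 hA
  · exact he.2 i hi

end MSunflower

end Summit.CriticalPhenomena.PercolationContinuityZ3.Theorems.SunflowerPartition
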